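import Summits.BirchSwinnertonDyer.BirchSwinnertonDyer.Theorems.QuadraticBranchSignedControlPlusEtaNonsurjPlusCoeffCongruenceHigher
import Summits.BirchSwinnertonDyer.Rank1Residual.X11a.LambdaNorm
import HarnessLib

/-!
# Route `QuadraticBranchSignedControl` (rung K8, cell `bsd-potss`), residual crux `PlusEtaMainConjectureNonsurj`
# (stmt-BirchSwinnertonDyer-19606): THE μ⁺-CERTIFICATE AND THE λ⁺-READING — `μ(L_p⁺(V, η, X)) = 0` and `λ(L_p⁺(V, η, X)) = λ` (when `λ < p − 1`)
# READ OFF `λ + 1` EXACT RATIONALS, the low modular-symbol moments of ONE even-level Mazur–Tate element `θ_{2m}(η)`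
# (seat `bsd-potss-k8eta-c2` g25; sequel of `…PlusCoeffCongruenceHigher.lean`, plus twin of g24's `…MinusCoeffCongruenceLambda.lean`)

WHY. v7's content stub `stub_analyticEtaMu_cm` (skeleton 39fd0f5855aa) is «`HasUnitContent Lη` for every plus branch function
`Lη = L_p⁺(V,η,X)` of every CM row» — analytic `μ⁺ = 0`, so far MEASURED per row by PARI's `ellpadiclambdamu` (k8eta-c2 g3/g17/g18/g19:
`μ = 0` on 13805 + 14842 + 6358 rows, numerics only). THIS FILE turns `μ⁺ = 0` (and `λ⁺`, when `< p − 1`) into a KERNEL consequence of a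
finite displayed datum: by the unitriangular identity of the prequel (`exists_coeff_mazurTate_plus_eq_sum`:
`coeff_kθ_{2m}(η) = (−1)^{m+1}Σ_{s+t=k}(ω⁻_{2m})_s·coeff_tM⁺ + p^{2m}r`, diagonal `(ω⁻_{2m})_0 = p^m`, `p^m ∣ (ω⁻_{2m})_s` for `0 < s < p−1`)
and `Lη = v·ϖ·M⁺` (`v ∈ ℤ_pˣ`), for `m ≥ 1` and `λ < p − 1`:
«`‖ϖ·coeff_jθ_{2m}(η)‖_p ≤ p^{−(m+1)}` for `j < λ` and `‖ϖ·coeff_λθ_{2m}(η)‖_p = p^{−m}` ⟹ `coeff_jLη ∉ ℤ_pˣ` (`j < λ`), `coeff_λLη ∈ ℤ_pˣ`»,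
i.e. `HasUnitContent Lη`, `μ(Lη) = 0`, `λ(Lη) = λ` in the tree's vocabulary (`X1.MuLambda.mu/lam`, b2b's `normLam`). The `λ + 1` rationals
`coeff_jθ_{2m}(η) = Σ_u C(u,j)·TH_{2m}[u]` are binomial moments of the `η`-signed modular symbols `[a/p^{2m+1}]^δ` (g23/g24's engine, stage 2);
at `p = 5`, level `2` decides every `λ⁺ ≤ 3` — by parity (`λ⁺ ≡ r_an(W) (mod 2)`) every CM row of g18's census with `λ⁺ < 4` (`λ⁺ = 0`: 2006,
`λ⁺ = 2`: 455 at `ε(W) = +1`; `λ⁺ = 1`: 2273, `λ⁺ = 3`: 520 at `ε(W) = −1`, `p = 5` quadratic families). `λ⁺ = 0` needs no `m ≥ 1`: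
`coeff₀θ_{2m}(η) = (−1)^{m+1}p^m·M⁺(0)` EXACTLY (prequel), so `‖ϖ·θ_{2m}(η)(0)‖ = p^{−m}` at ANY `m` (at `m = 0`: Kobayashi (3.6),
`‖ϖ·Σ_a η(a)[a/p]^δ‖ = 1`) certifies `Lη(0) ∈ ℤ_pˣ`.

WHAT. §10 `norm_sub_le_of_forall_norm_le_plus` (one step: `‖ϖθ_k − (−1)^{m+1}p^mϖM⁺_k‖ ≤ p^{−(m+1)}` once `‖ϖM⁺_t‖ ≤ p^{−1}` for `t < k`;
`m ≥ 1`, `k < p − 1`), `forall_norm_le_of_forall_norm_theta_le_plus` (the induction from `j = 0`), `lambda_reading_plus_of_padicNorm` (the reading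
for every `L`), `isUnit_constantCoeff_plus_of_padicNorm` (`λ = 0` at any `m`); §11 the bridge `hasUnitContent_and_mu_lam_of_firstUnitCoeff`
(first-unit-coefficient shape ⟹ `HasUnitContent ∧ μ = 0 ∧ lam = λ ∧ normLam = λ`, pure `Λ`-algebra) and the record-facing
`hasUnitContent_and_mu_lam_plus_of_padicNorm[_zero]`. The CONVERSE readings (the pattern is
EQUIVALENT to «`μ = 0 ∧ λ = λ₀`», both signs) and the row-currency forms are the sequel `…PlusCoeffCongruenceMuCertificate.lean`.

HONEST FRAMING (cell `bsd-potss`; FULL-BSD rank ≤ 1 programme, HUMAN RULING D-0036/D-0074): TOOL THEOREMS ONLY — no definition, no named fact,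
no `sorry`, axioms standard; the symbol valuations stay DISPLAYED per-row hypotheses; nothing about (A), (C1⁺_η), C-cc-1 or `BSD(W,p)` of any pair
is claimed; `stub_analyticEtaMu_cm` is NOT proved (it is a class-wide `∀`; this is its per-row certificate shape); crux and route OPEN; nothing
booked. `--supports stmt-BirchSwinnertonDyer-19606`.

References: [Pollack2003] Prop. 6.18, §6.5; [Kobayashi2003] Thm. 3.2, (3.4), (3.6) (p. 7); [Washington1997] §7.1 (λ, μ of an Iwasawa function);
[GreenbergVatsal2000] p. 2 (1)–(2).
-/

set_option autoImplicit false
set_option linter.dupNamespace false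
noncomputable section

open scoped Classical MatrixGroups ModularForm

open CongruenceSubgroup Polynomial Literature.NumberTheory.EllipticCurves
  Literature.NumberTheory.EllipticCurves.ModularForms
  Literature.NumberTheory.EllipticCurves.GreenbergVatsal2000
open Summit.BirchSwinnertonDyer.Rank1Residual Summit.BirchSwinnertonDyer.Rank1Residual.Additive
open Summit.BirchSwinnertonDyer.BirchSwinnertonDyer.Theorems.EtaMinusCoeffCongruence

namespace Summit.BirchSwinnertonDyer.BirchSwinnertonDyer.Theorems.EtaPlusCoeffCongruence

variable {p : ℕ} [hp : Fact p.Prime] {N : ℕ} [NeZero N] {f : CuspForm (Gamma0 N) 2}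

/-! ## §10 The λ⁺-reading -/

omit [NeZero N] in
/-- **One step of the triangular induction (plus side).** From the identity
`coeff_kθ = (−1)^{m+1}Σ_{s+t=k}(ω⁻_{2m})_s·coeff_tM + p^{2m}r` (`k < p − 1`, `m ≥ 1`), `‖ϖ‖_p ≤ 1` and `‖ϖ·coeff_tM‖ ≤ p^{−1}` for all `t < k`:
`‖ϖ·coeff_kθ − (−1)^{m+1}p^m·ϖ·coeff_kM‖ ≤ p^{−(m+1)}` (the off-diagonal terms have `p^m ∣ (ω⁻_{2m})_s`, `1 ≤ s < p − 1`, times a factor of norm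
`≤ p^{−1}`; the remainder has norm `≤ p^{−2m} ≤ p^{−(m+1)}`). [cite: Pollack2003, Prop. 6.18] -/
theorem norm_sub_le_of_forall_norm_le_plus (m : ℕ) (hm : 1 ≤ m) {k : ℕ} (hk : k < p - 1) {M : IwasawaAlgebra p} {θk : ℚ_[p]}
    {r : ℤ_[p]}
    (hid : θk = (-1) ^ (m + 1) * (∑ x ∈ Finset.HasAntidiagonal.antidiagonal k,
        (((cyclotomicOmegaMinus p (2 * m)).coeff x.1 : ℤ) : ℚ_[p]) * ((PowerSeries.coeff x.2 M : ℤ_[p]) : ℚ_[p])) +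
        (p : ℚ_[p]) ^ (2 * m) * (r : ℚ_[p]))
    {ϖ : ℚ_[p]} (hϖ : ‖ϖ‖ ≤ 1)
    (hIH : ∀ t < k, ‖ϖ * ((PowerSeries.coeff t M : ℤ_[p]) : ℚ_[p])‖ ≤ (p : ℝ)⁻¹) :
    ‖ϖ * θk - (-1) ^ (m + 1) * (p : ℚ_[p]) ^ m * (ϖ * ((PowerSeries.coeff k M : ℤ_[p]) : ℚ_[p]))‖ ≤
      ((p : ℝ)⁻¹) ^ (m + 1) := by
  have hP : p.Prime := hp.out
  have hp1 : (1 : ℝ) < p := by exact_mod_cast hP.one_lt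
  have hp0 : (0 : ℝ) < p := by positivity
  have hpi0 : (0 : ℝ) ≤ (p : ℝ)⁻¹ := inv_nonneg.mpr hp0.le
  have hpi1 : (p : ℝ)⁻¹ ≤ 1 := inv_le_one_of_one_le₀ hp1.le
  set S := Finset.HasAntidiagonal.antidiagonal k with hS
  set g : ℕ × ℕ → ℚ_[p] := fun x ↦
    (((cyclotomicOmegaMinus p (2 * m)).coeff x.1 : ℤ) : ℚ_[p]) * ((PowerSeries.coeff x.2 M : ℤ_[p]) : ℚ_[p]) with hg
  have hmem : ((0, k) : ℕ × ℕ) ∈ S := by rw [hS, Finset.HasAntidiagonal.mem_antidiagonal]; simp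
  have hsplit := Finset.add_sum_erase S g hmem
  have hg0 : g (0, k) = (p : ℚ_[p]) ^ m * ((PowerSeries.coeff k M : ℤ_[p]) : ℚ_[p]) := by
    rw [hg]
    dsimp only
    rw [coeff_zero_cyclotomicOmegaMinus_two_mul]
    push_cast
    ring
  -- the difference is `ε ϖ Σ_{erase} + p^{2m} ϖ r`
  have hms : ϖ * ∑ x ∈ S.erase (0, k), g x = ∑ x ∈ S.erase (0, k), ϖ * g x := by rw [Finset.mul_sum]
  have hdiff : ϖ * θk - (-1) ^ (m + 1) * (p : ℚ_[p]) ^ m * (ϖ * ((PowerSeries.coeff k M : ℤ_[p]) : ℚ_[p])) =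
      (-1) ^ (m + 1) * ∑ x ∈ S.erase (0, k), ϖ * g x + (p : ℚ_[p]) ^ (2 * m) * (ϖ * (r : ℚ_[p])) := by
    rw [← hms, hid, ← hsplit, hg0]
    ring
  rw [hdiff]
  -- bound each off-diagonal term
  have hterm : ∀ x ∈ S.erase (0, k), ‖ϖ * g x‖ ≤ ((p : ℝ)⁻¹) ^ (m + 1) := by
    intro x hx
    obtain ⟨hne, hxS⟩ := Finset.mem_erase.mp hx
    have hsum : x.1 + x.2 = k := by rw [hS] at hxS; exact Finset.HasAntidiagonal.mem_antidiagonal.mp hxS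
    have hx1 : 1 ≤ x.1 := by
      rcases Nat.eq_zero_or_pos x.1 with h0 | h0
      · exact absurd (Prod.ext h0 (by show x.2 = k; omega)) hne
      · exact h0
    have hx1lt : x.1 < p - 1 := by omega
    have hdvd := pow_dvd_coeff_cyclotomicOmegaMinus_two_mul (p := p) m x.1 hx1lt
    have hω : ‖(((cyclotomicOmegaMinus p (2 * m)).coeff x.1 : ℤ) : ℚ_[p])‖ ≤ (p : ℝ) ^ (-(m : ℤ)) :=
      (Padic.norm_int_le_pow_iff_dvd _ _).mpr (by exact_mod_cast hdvd)
    have hMt := hIH x.2 (by omega)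
    rw [hg]
    dsimp only
    calc ‖ϖ * ((((cyclotomicOmegaMinus p (2 * m)).coeff x.1 : ℤ) : ℚ_[p]) *
          ((PowerSeries.coeff x.2 M : ℤ_[p]) : ℚ_[p]))‖
        = ‖(((cyclotomicOmegaMinus p (2 * m)).coeff x.1 : ℤ) : ℚ_[p])‖ *
            ‖ϖ * ((PowerSeries.coeff x.2 M : ℤ_[p]) : ℚ_[p])‖ := by
          rw [← norm_mul]; ring_nf
      _ ≤ (p : ℝ) ^ (-(m : ℤ)) * (p : ℝ)⁻¹ := mul_le_mul hω hMt (norm_nonneg _) (by positivity)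
      _ = ((p : ℝ)⁻¹) ^ (m + 1) := by rw [zpow_neg, zpow_natCast, ← inv_pow, pow_succ]
  have hsum_le : ‖∑ x ∈ S.erase (0, k), ϖ * g x‖ ≤ ((p : ℝ)⁻¹) ^ (m + 1) :=
    IsUltrametricDist.norm_sum_le_of_forall_le_of_nonneg (by positivity) hterm
  have hA : ‖(-1 : ℚ_[p]) ^ (m + 1) * ∑ x ∈ S.erase (0, k), ϖ * g x‖ ≤ ((p : ℝ)⁻¹) ^ (m + 1) := by
    rw [norm_mul, norm_pow, norm_neg, norm_one, one_pow, one_mul]; exact hsum_le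
  have hB : ‖(p : ℚ_[p]) ^ (2 * m) * (ϖ * (r : ℚ_[p]))‖ ≤ ((p : ℝ)⁻¹) ^ (m + 1) := by
    rw [norm_mul, norm_mul, norm_pow, Padic.norm_p, PadicInt.padic_norm_e_of_padicInt]
    calc ((p : ℝ)⁻¹) ^ (2 * m) * (‖ϖ‖ * ‖r‖) ≤ ((p : ℝ)⁻¹) ^ (2 * m) * (1 * 1) := by
          gcongr
          exact PadicInt.norm_le_one r
      _ ≤ ((p : ℝ)⁻¹) ^ (m + 1) := by
          rw [mul_one, mul_one]; exact pow_le_pow_of_le_one hpi0 hpi1 (by omega)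
  exact (IsUltrametricDist.norm_add_le_max _ _).trans (max_le hA hB)

/-- **The triangular induction (plus side).** `p` odd, `f` a rational newform of level prime to `p` with `a_p = 0`, `M` with the even-level
congruence at level `2m` (`m ≥ 1`), `‖ϖ‖_p ≤ 1`, `λ < p − 1`: if `‖ϖ·coeff_jθ_{2m}(η)‖ ≤ p^{−(m+1)}` for all `j < λ` (from `j = 0`: on the plus
side `M⁺(0)` is NOT automatically `0`) then `‖ϖ·coeff_jM‖ ≤ p^{−1}` for all `j < λ`. [cite: Pollack2003, Prop. 6.18] -/
theorem forall_norm_le_of_forall_norm_theta_le_plus (hp2 : p ≠ 2) (hf0 : IsNewform0 f) (hQ : coeffField f = ⊥)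
    (hpN : ¬ p ∣ N) (hap : cuspCoeff f p = ((0 : ℤ) : ℂ)) (m : ℕ) (hm : 1 ≤ m) {lam : ℕ} (hlam : lam < p - 1)
    {M : IwasawaAlgebra p}
    (hM : IsCongrModOmega p (2 * m) (quadraticBranchMazurTateElement p f (2 * m))
      ((-1) ^ (m + 1) * cyclotomicOmegaMinus p (2 * m)) M)
    {ϖ : ℚ_[p]} (hϖ : ‖ϖ‖ ≤ 1)
    (hθ : ∀ j < lam,
      ‖ϖ * (((quadraticBranchMazurTateElement p f (2 * m)).coeff j : ℚ) : ℚ_[p])‖ ≤ ((p : ℝ)⁻¹) ^ (m + 1)) :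
    ∀ j < lam, ‖ϖ * ((PowerSeries.coeff j M : ℤ_[p]) : ℚ_[p])‖ ≤ (p : ℝ)⁻¹ := by
  have hP : p.Prime := hp.out
  have hp1 : (1 : ℝ) < p := by exact_mod_cast hP.one_lt
  have hp0 : (0 : ℝ) < p := by positivity
  intro j
  induction j using Nat.strong_induction_on with
  | _ j ih =>
    intro hj
    obtain ⟨r, hr⟩ := exists_coeff_mazurTate_plus_eq_sum hp2 hf0 hQ hpN hap m (show j < p by omega) hM
    have hstep := norm_sub_le_of_forall_norm_le_plus m hm (show j < p - 1 by omega) hr hϖ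
      (fun t ht ↦ ih t ht (by omega))
    have hθj := hθ j hj
    -- `‖ε p^m ϖ M_j‖ ≤ p^{-(m+1)}` by the ultrametric inequality
    set a : ℚ_[p] := ϖ * (((quadraticBranchMazurTateElement p f (2 * m)).coeff j : ℚ) : ℚ_[p]) with ha
    set b : ℚ_[p] := (-1 : ℚ_[p]) ^ (m + 1) * (p : ℚ_[p]) ^ m *
      (ϖ * ((PowerSeries.coeff j M : ℤ_[p]) : ℚ_[p])) with hb
    have hle : ‖b‖ ≤ ((p : ℝ)⁻¹) ^ (m + 1) := by
      have e : b = a + -(a - b) := by ring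
      rw [e]
      refine (IsUltrametricDist.norm_add_le_max _ _).trans (max_le hθj ?_)
      rw [norm_neg]
      exact hstep
    rw [hb] at hle
    rw [norm_mul, norm_mul, norm_pow, norm_neg, norm_one, one_pow, one_mul, norm_pow, Padic.norm_p, pow_succ] at hle
    have hpm : (0 : ℝ) < ((p : ℝ)⁻¹) ^ m := pow_pos (inv_pos.mpr hp0) m
    exact le_of_mul_le_mul_left hle hpm

/-- **THE λ⁺-READING.** `p` odd, `f` a rational newform of level `N` prime to `p` with `a_p(f) = 0`, `ϖ ∈ ℚ` with `‖ϖ‖_p ≤ 1`, `L` ANY function with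
`IsQuadraticBranchPlusLFunction f p ϖ L`, `m ≥ 1`, `λ < p − 1`. DISPLAYED (finite symbol data, `θ = quadraticBranchMazurTateElement p f (2m)`):
`‖ϖ·coeff_jθ‖_p ≤ p^{−(m+1)}` for `j < λ` and `‖ϖ·coeff_λθ‖_p = p^{−m}`. CONCLUSION: `coeff_jL ∉ ℤ_pˣ` for every `j < λ` and `coeff_λL ∈ ℤ_pˣ` —
`μ(L) = 0` and `λ(L) = λ`: the Iwasawa invariants of `L_p⁺(V,η,X)` read off `λ + 1` exact rationals. [cite: Pollack2003, Prop. 6.18]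
[cite: Kobayashi2003, Thm. 3.2, (3.4), (3.6) (p. 7)] [cite: Washington1997, §7.1] -/
theorem lambda_reading_plus_of_padicNorm (hp2 : p ≠ 2) (hf0 : IsNewform0 f) (hQ : coeffField f = ⊥)
    (hpN : ¬ p ∣ N) (hap : cuspCoeff f p = ((0 : ℤ) : ℂ)) {ϖ : ℚ} (hϖ : ‖(ϖ : ℚ_[p])‖ ≤ 1)
    {L : IwasawaAlgebra p} (hL : IsQuadraticBranchPlusLFunction f p ϖ L) (m : ℕ) (hm : 1 ≤ m) {lam : ℕ}
    (hlam : lam < p - 1)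
    (hlow : ∀ j < lam,
      ‖(ϖ : ℚ_[p]) * (((quadraticBranchMazurTateElement p f (2 * m)).coeff j : ℚ) : ℚ_[p])‖ ≤ ((p : ℝ)⁻¹) ^ (m + 1))
    (htop : ‖(ϖ : ℚ_[p]) * (((quadraticBranchMazurTateElement p f (2 * m)).coeff lam : ℚ) : ℚ_[p])‖ = ((p : ℝ)⁻¹) ^ m) :
    (∀ j < lam, ¬ IsUnit (PowerSeries.coeff j L)) ∧ IsUnit (PowerSeries.coeff lam L) := by
  have hP : p.Prime := hp.out
  have hp1 : (1 : ℝ) < p := by exact_mod_cast hP.one_lt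
  have hp0 : (0 : ℝ) < p := by positivity
  obtain ⟨M, hM⟩ := exists_isCongrModOmega_quadraticBranch_even hp2 hf0 hQ hpN hap
  obtain ⟨v, hv⟩ := exists_units_forall_coeff_eq_plus hp2 hϖ hL hM
  have hsmall := forall_norm_le_of_forall_norm_theta_le_plus hp2 hf0 hQ hpN hap m hm hlam (hM m) hϖ hlow
  have hnormL : ∀ j, ‖PowerSeries.coeff j L‖ = ‖(ϖ : ℚ_[p]) * ((PowerSeries.coeff j M : ℤ_[p]) : ℚ_[p])‖ := by
    intro j
    rw [PadicInt.norm_def, hv j, norm_mul, PadicInt.padic_norm_e_of_padicInt, PadicInt.norm_units, one_mul]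
  refine ⟨fun j hj hu ↦ ?_, ?_⟩
  · have h1 : ‖PowerSeries.coeff j L‖ = 1 := PadicInt.isUnit_iff.mp hu
    rw [hnormL] at h1
    have h2 := hsmall j hj
    rw [h1] at h2
    exact absurd h2 (not_le.mpr (inv_lt_one_of_one_lt₀ hp1))
  · -- the top coefficient: `‖ε p^m ϖ M_λ‖ = ‖ϖ θ_λ‖ = p^{-m}`
    obtain ⟨r, hr⟩ := exists_coeff_mazurTate_plus_eq_sum hp2 hf0 hQ hpN hap m (show lam < p by omega) (hM m)
    have hstep := norm_sub_le_of_forall_norm_le_plus m hm hlam hr hϖ hsmall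
    set a : ℚ_[p] := (ϖ : ℚ_[p]) * (((quadraticBranchMazurTateElement p f (2 * m)).coeff lam : ℚ) : ℚ_[p]) with ha
    set b : ℚ_[p] := (-1 : ℚ_[p]) ^ (m + 1) * (p : ℚ_[p]) ^ m *
      ((ϖ : ℚ_[p]) * ((PowerSeries.coeff lam M : ℤ_[p]) : ℚ_[p])) with hb
    have hlt : ‖a - b‖ < ‖a‖ := by
      rw [htop]
      refine hstep.trans_lt ?_
      rw [pow_succ]
      exact mul_lt_of_lt_one_right (pow_pos (inv_pos.mpr hp0) m) (inv_lt_one_of_one_lt₀ hp1)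
    have hnb : ‖b‖ = ‖a‖ := by
      have h := Padic.add_eq_max_of_ne (p := p) (q := a - b) (r := b) (by
        intro heq
        rw [heq] at hlt
        have := IsUltrametricDist.norm_add_le_max (a - b) b
        rw [sub_add_cancel, heq, max_self] at this
        exact absurd (lt_of_le_of_lt this hlt) (lt_irrefl _))
      rw [sub_add_cancel] at h
      rcases le_total ‖a - b‖ ‖b‖ with hle | hle
      · rw [max_eq_right hle] at h; exact h.symm
      · rw [max_eq_left hle] at h; exact absurd h (ne_of_gt hlt)
    rw [htop, hb, norm_mul, norm_mul, norm_pow, norm_neg, norm_one, one_pow, one_mul, norm_pow, Padic.norm_p] at hnb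
    have hone : ‖(ϖ : ℚ_[p]) * ((PowerSeries.coeff lam M : ℤ_[p]) : ℚ_[p])‖ = 1 := by
      have hpm : ((p : ℝ)⁻¹) ^ m ≠ 0 := pow_ne_zero _ (inv_ne_zero hp0.ne')
      field_simp at hnb
      linarith [hnb]
    exact PadicInt.isUnit_iff.mpr (by rw [hnormL, hone])

/-- **`λ⁺ = 0` at ANY level (no `m ≥ 1`, no remainder).** `coeff₀θ_{2m}(η) = (−1)^{m+1}p^m·M⁺(0)` EXACTLY (prequel `coeff_zero_mazurTate_plus_eq`), so
`‖ϖ·θ_{2m}(η)(0)‖_p = p^{−m}` (DISPLAYED; at `m = 0` this is `‖ϖ·Σ_a η(a)[a/p]^δ_f‖_p = 1`, Kobayashi (3.6)) gives `L(0) ∈ ℤ_pˣ` for every plus branch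
function `L` — `μ(L) = λ(L) = 0`, `L ∈ Λˣ`. [cite: Kobayashi2003, (3.6) (p. 7)] [cite: Pollack2003, Prop. 6.18] -/
theorem isUnit_constantCoeff_plus_of_padicNorm (hp2 : p ≠ 2) (hf0 : IsNewform0 f) (hQ : coeffField f = ⊥)
    (hpN : ¬ p ∣ N) (hap : cuspCoeff f p = ((0 : ℤ) : ℂ)) {ϖ : ℚ} (hϖ : ‖(ϖ : ℚ_[p])‖ ≤ 1)
    {L : IwasawaAlgebra p} (hL : IsQuadraticBranchPlusLFunction f p ϖ L) (m : ℕ)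
    (h0 : ‖(ϖ : ℚ_[p]) * (((quadraticBranchMazurTateElement p f (2 * m)).coeff 0 : ℚ) : ℚ_[p])‖ = ((p : ℝ)⁻¹) ^ m) :
    IsUnit (PowerSeries.constantCoeff L) := by
  have hP : p.Prime := hp.out
  have hp0 : (0 : ℝ) < p := by exact_mod_cast hP.pos
  obtain ⟨M, hM⟩ := exists_isCongrModOmega_quadraticBranch_even hp2 hf0 hQ hpN hap
  obtain ⟨v, hv⟩ := exists_units_forall_coeff_eq_plus hp2 hϖ hL hM
  have hid := coeff_zero_mazurTate_plus_eq hp2 hf0 hQ hpN hap m (hM m)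
  rw [hid] at h0
  rw [show (ϖ : ℚ_[p]) * ((-1) ^ (m + 1) * (p : ℚ_[p]) ^ m * ((PowerSeries.constantCoeff M : ℤ_[p]) : ℚ_[p])) =
      (-1) ^ (m + 1) * (p : ℚ_[p]) ^ m * ((ϖ : ℚ_[p]) * ((PowerSeries.constantCoeff M : ℤ_[p]) : ℚ_[p])) by ring,
    norm_mul, norm_mul, norm_pow, norm_neg, norm_one, one_pow, one_mul, norm_pow, Padic.norm_p] at h0
  have hone : ‖(ϖ : ℚ_[p]) * ((PowerSeries.constantCoeff M : ℤ_[p]) : ℚ_[p])‖ = 1 := by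
    have hpm : ((p : ℝ)⁻¹) ^ m ≠ 0 := pow_ne_zero _ (inv_ne_zero hp0.ne')
    field_simp at h0
    linarith [h0]
  have hn : ‖PowerSeries.constantCoeff L‖ = 1 := by
    rw [← PowerSeries.coeff_zero_eq_constantCoeff_apply, PadicInt.norm_def, hv 0, norm_mul,
      PadicInt.padic_norm_e_of_padicInt, PadicInt.norm_units, one_mul, PowerSeries.coeff_zero_eq_constantCoeff_apply, hone]
  exact PadicInt.isUnit_iff.mpr hn

/-! ## §11 The bridge to the tree's `μ` / `λ` vocabulary and the record-facing forms -/

omit [NeZero N] in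
/-- **First-unit-coefficient shape ⟹ the tree's invariants** (pure `Λ`-algebra): if `coeff_j L ∉ ℤ_pˣ` for `j < λ` and `coeff_λ L ∈ ℤ_pˣ` then
`HasUnitContent L` (Greenberg–Vatsal's `μ = 0`), `X1.MuLambda.mu L = 0`, `X1.MuLambda.lam L = λ` (eisenstein-p1's invariants) and `normLam L = λ`
(b2b's valued `λ`). [cite: Washington1997, §7.1 (Prop. 7.2, Thm. 7.3)] [cite: GreenbergVatsal2000, p. 2, (1)–(2)] -/
theorem hasUnitContent_and_mu_lam_of_firstUnitCoeff {L : IwasawaAlgebra p} {lam : ℕ}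
    (h : (∀ j < lam, ¬ IsUnit (PowerSeries.coeff j L)) ∧ IsUnit (PowerSeries.coeff lam L)) :
    HasUnitContent L ∧ X1.MuLambda.mu L = 0 ∧ X1.MuLambda.lam L = lam ∧ normLam L = lam := by
  have hU : HasUnitContent L := ⟨lam, h.2⟩
  have h1 : ‖PowerSeries.coeff lam L‖ = 1 := PadicInt.isUnit_iff.mp h.2
  have h' : ∃ n, ‖PowerSeries.coeff n L‖ = 1 := ⟨lam, h1⟩
  have hn : normLam L = lam := by
    refine (X11a.LambdaNorm.normLam_eq_iff (X11a.LambdaNorm.hasMaxCoeff_of_exists_norm_eq_one h') lam).mpr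
      ⟨X11a.LambdaNorm.isMaxCoeffAt_of_norm_eq_one h1, fun j hj ↦ ?_⟩
    rw [h1]
    exact lt_of_le_of_ne (PadicInt.norm_le_one _) fun heq ↦ h.1 j hj (PadicInt.isUnit_iff.mpr heq)
  have hred : X1.MuLambda.red L ≠ 0 :=
    (X11a.LambdaNorm.exists_norm_coeff_eq_one_iff_map_residue_ne_zero L).mp h'
  have hmu : X1.MuLambda.mu L = 0 := (X1.MuLambda.mu_eq_and_pfree_eq (a := 0) hred (by simp)).1
  exact ⟨hU, hmu, (X11a.LambdaNorm.lam_eq_normLam hU).trans hn, hn⟩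

/-- **THE μ⁺-CERTIFICATE (record-facing).** For every plus branch function `L` of a rational `a_p = 0` newform `f` (level prime to the odd prime `p`,
`‖ϖ‖_p ≤ 1`): `m ≥ 1`, `λ < p − 1` and the DISPLAYED valuations «`‖ϖ·coeff_jθ_{2m}(η)‖ ≤ p^{−(m+1)}` (`j < λ`), `‖ϖ·coeff_λθ_{2m}(η)‖ = p^{−m}`» give
`HasUnitContent L` — verbatim the conclusion of v7's `stub_analyticEtaMu_cm` for this `L` — together with `μ(L) = 0`, `λ(L) = λ`.
[cite: Pollack2003, Prop. 6.18] [cite: Kobayashi2003, Thm. 3.2, (3.4), (3.6) (p. 7)] [cite: GreenbergVatsal2000, p. 2, (1)–(2)] -/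
theorem hasUnitContent_and_mu_lam_plus_of_padicNorm (hp2 : p ≠ 2) (hf0 : IsNewform0 f) (hQ : coeffField f = ⊥)
    (hpN : ¬ p ∣ N) (hap : cuspCoeff f p = ((0 : ℤ) : ℂ)) {ϖ : ℚ} (hϖ : ‖(ϖ : ℚ_[p])‖ ≤ 1)
    {L : IwasawaAlgebra p} (hL : IsQuadraticBranchPlusLFunction f p ϖ L) (m : ℕ) (hm : 1 ≤ m) {lam : ℕ}
    (hlam : lam < p - 1)
    (hlow : ∀ j < lam,
      ‖(ϖ : ℚ_[p]) * (((quadraticBranchMazurTateElement p f (2 * m)).coeff j : ℚ) : ℚ_[p])‖ ≤ ((p : ℝ)⁻¹) ^ (m + 1))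
    (htop : ‖(ϖ : ℚ_[p]) * (((quadraticBranchMazurTateElement p f (2 * m)).coeff lam : ℚ) : ℚ_[p])‖ = ((p : ℝ)⁻¹) ^ m) :
    HasUnitContent L ∧ X1.MuLambda.mu L = 0 ∧ X1.MuLambda.lam L = lam ∧ normLam L = lam :=
  hasUnitContent_and_mu_lam_of_firstUnitCoeff
    (lambda_reading_plus_of_padicNorm hp2 hf0 hQ hpN hap hϖ hL m hm hlam hlow htop)

/-- **THE μ⁺-CERTIFICATE at `λ⁺ = 0` (record-facing, any level `m`).** `‖ϖ·θ_{2m}(η)(0)‖_p = p^{−m}` gives `HasUnitContent L`, `μ(L) = 0`,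
`λ(L) = 0` for every plus branch function `L` (indeed `L ∈ Λˣ`). [cite: Kobayashi2003, (3.6) (p. 7)] [cite: GreenbergVatsal2000, p. 2, (1)–(2)] -/
theorem hasUnitContent_and_mu_lam_plus_of_padicNorm_zero (hp2 : p ≠ 2) (hf0 : IsNewform0 f)
    (hQ : coeffField f = ⊥) (hpN : ¬ p ∣ N) (hap : cuspCoeff f p = ((0 : ℤ) : ℂ)) {ϖ : ℚ} (hϖ : ‖(ϖ : ℚ_[p])‖ ≤ 1)
    {L : IwasawaAlgebra p} (hL : IsQuadraticBranchPlusLFunction f p ϖ L) (m : ℕ)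
    (h0 : ‖(ϖ : ℚ_[p]) * (((quadraticBranchMazurTateElement p f (2 * m)).coeff 0 : ℚ) : ℚ_[p])‖ = ((p : ℝ)⁻¹) ^ m) :
    HasUnitContent L ∧ X1.MuLambda.mu L = 0 ∧ X1.MuLambda.lam L = 0 ∧ normLam L = 0 := by
  refine hasUnitContent_and_mu_lam_of_firstUnitCoeff ⟨fun j hj ↦ absurd hj (Nat.not_lt_zero j), ?_⟩
  rw [PowerSeries.coeff_zero_eq_constantCoeff_apply]
  exact isUnit_constantCoeff_plus_of_padicNorm hp2 hf0 hQ hpN hap hϖ hL m h0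

end Summit.BirchSwinnertonDyer.BirchSwinnertonDyer.Theorems.EtaPlusCoeffCongruence

end
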